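/- Copyright: the b2b-balaban cell (near-miss cell 7), T⁴-continuum fan-out, lineage t4-ne7b-p1 (node U5c COUNT
member).  Released under the licence of the surrounding project. -/
import Summits.QuantumFields.BalabanUV.T4Continuum.Support.HistoryBankingPedigreeLedger
import Summits.QuantumFields.BalabanUV.T4Continuum.Support.HistoryGenealogyJunctionV

/-!
# M5-2b — THE FOREST VOLUME IDENTITY: the level-by-level volume of a component history, regrouped along the pedigrees
of the components live at the cutoff and of those that died earlier; realised volumes below the maximal ones (owner
module of row NE7b, lineage `t4-ne7b-p1` gen 44; re-open object (α), `SCOPE-alpha.md` v2.6, M5-2 «the witness plug»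
part (b); PRE-POSITIONING ONLY)

Summits-side support leaf of the T⁴-continuum cell (rung (B)+1 on a FINITE torus only; NOT infinite volume, NOT the
mass gap, NOT the Clay statement; NOT a proof of the spine estimate NE7b — the cell's OWN estimate, NOT PRINTED, NOT
PROVED).  [folklore] finite combinatorics and real arithmetic over the owner's `HistoryGenealogyExtraction.ComponentHistory`
(`comp`, `parts`, `died`, `sum_comp_eq_continued_add_died`), `HistoryGenealogyPedigree.pedOf` ∕ `toPGen_succ`,
`HistoryGen.chainJoin` ∕ `Pedigree.joinP`, A3a∕A3b (`HistoryBankingPedigreeMax.MDP`, `curDomain_subset_MDP`;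
`HistoryBankingPedigreeLedger.compSum`, `compSum_of_le`) and the pass-V junction (`HistoryGenealogyJunctionV`: `histV`,
`pedMV`, `realisesW_pedMV`, `domL_eq_curDomain_pedMV`, `prod_pow_card_comp_histV`); nothing printed is asserted, no
`def … : Prop` fact of Bałaban's, no cite-tagged hypothesis, zero `sorry`.  One `def` (`treeVol`, a finite sum).
B16 = [Balaban1989LargeFieldII] pp. 380–387 under audit; locators only.

WHY (M5-2 (b), `ROW-NE7b-STATE.md` v1.23 §5).  M2 brick B (`B16HistoryInputFamily.weight_le_evProd`) bounds a term's
weight by `(∏_{j ≤ K} ∏_{c ∈ histM.comp j} Λ K j ^ #c.2) · (event products) · rest` — the per-level cost of EVERY component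
of the process, in volume form, level by level.  M5-1b's flat ledger (`HistoryBankingFlatJunction.flat_volume_le_lifeCost`)
pays, per LIVE structure, the weighted MAXIMAL volume `Σ_m u_m·compSum id P m` of its pedigree.  THIS FILE joins the
two: the level-by-level sum regroups EXACTLY along the forest of pedigrees (live at `K`, or died at `j < K`), and the
realised volumes are below the maximal ones.

WHAT.  §1 `compSum` of a join chain ∕ of `joinP` BEFORE the join step is the sum over the members
(`compSum_chainJoin_of_lt`, `compSum_joinP_of_lt`).  §2 ONE-STEP ADDITIVITY along `pedOf` (under an admissible order):
for `c ∈ comp (j+1)` and `m ≤ j`, `compSum φ (toPGen id (j+1, c)) m = Σ_{p ∈ parts (j+1) c} compSum φ (toPGen id (j, p)) m`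
(`compSum_toPGen_succ`) — a renewed part is transparent, a new region of step `j + 1` contributes nothing at `m ≤ j`.
§3 **`forest_treeVol_eq`** (THE FOREST VOLUME IDENTITY, under `WF` and an admissible order): with
`treeVol … u K a := Σ_{m ≤ K} u_m·compSum φ (toPGen id a) m`,
`Σ_{c ∈ comp K} treeVol u K (K, c) + Σ_{j < K} Σ_{c ∈ died j} treeVol u j (j, c) = Σ_{m ≤ K} u_m·Σ_{c ∈ comp m} compSum φ
(toPGen id (m, c)) m` — the additive twin of the owner's `forest_evProd_eqR`.  §4 PASS V: `card_snd_le_compSum` — a live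
dissolved component's domain has at most `compSum id (pedMV.toPGen id (m, c)) m` cubes (realised ⊆ maximal, A3a);
**`sum_level_volume_le_forest`** and **`prod_pow_card_le_exp_forest`** — M2 brick B's volume factor
`∏_{j ≤ K} ∏_{c ∈ histM.comp j} Λ j ^ #c.2` (for `Λ ≥ 1`) is at most
`exp (Σ_{c ∈ histV.comp K} treeVol (log ∘ Λ) K (K, c) + Σ_{j < K} Σ_{c ∈ histV.died j} treeVol (log ∘ Λ) j (j, c))`, i.e. the
product over the LIVE pedigrees of `exp (treeVol)` times the same over the DEAD ones (`prod_pow_card_le_prod_exp_forest`).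

WHAT IS *NOT* DONE HERE.  M5-2c: the live factors `exp (treeVol (log ∘ Λ K) K (K, c))` against the booked life cost
(`flat_volume_le_lifeCost_genT`, κ := `costT`) in `pshapeTH` currency, and the dead factors' place in the resummation.
HONEST: index-model bookkeeping; NE7b NOT proved; spine 0∕9.  HONEST DEPENDENCY (cell): continuum YM on T⁴ ⇐ BetaPertH
∧ nine spine estimates (0∕9 proved); BetaPertH ⇐ (D1) ∧ (D4) ∧ CAP+tail.  This file changes none of it.
-/

open Finset
open Literature.MathematicalPhysics.QuantumFieldTheory.Balaban1983to89
open Literature.MathematicalPhysics.QuantumFieldTheory.Balaban1983to89.B13ScaleTransfer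
open Summit.QuantumFields.BalabanUV.T4Continuum.HistoryAdmissible
open Summit.QuantumFields.BalabanUV.T4Continuum.HistoryRealise
open Summit.QuantumFields.BalabanUV.T4Continuum.HistoryRealiseCells
open Summit.QuantumFields.BalabanUV.T4Continuum.HistoryRealiseWeak
open Summit.QuantumFields.BalabanUV.T4Continuum.HistoryGen
open Summit.QuantumFields.BalabanUV.T4Continuum.HistoryGenealogyExtraction
open Summit.QuantumFields.BalabanUV.T4Continuum.HistoryGenealogyPedigree
open Summit.QuantumFields.BalabanUV.T4Continuum.HistoryGenealogyInstantiate
open Summit.QuantumFields.BalabanUV.T4Continuum.HistoryBankingPedigreeMax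
open Summit.QuantumFields.BalabanUV.T4Continuum.HistoryBankingPedigreeLedger

namespace Summit.QuantumFields.BalabanUV.T4Continuum.HistoryBankingForestVolume

noncomputable section

open scoped Classical

variable {d : ℕ}

/-! ## §1 `compSum` of a join chain before the join step -/

section Chain

variable {L : ℕ} {s : ℕ → ℕ} {φ : ℕ → ℝ}

/-- a renewal is transparent for the component sum [folklore] -/
@[simp] theorem compSum_renew (G : PGen (Pt d × Finset (Pt d))) (h m : ℕ) :
    compSum L s φ (.renew G h) m = compSum L s φ G m := rfl

/-- a birth contributes nothing before its step [folklore] -/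
theorem compSum_birth_of_lt {j cls : ℕ} {zZ : Pt d × Finset (Pt d)} {m : ℕ} (h : m < j) :
    compSum L s φ (.birth j cls zZ) m = 0 := by
  unfold compSum; rw [if_neg (Nat.not_le.2 h)]

/-- before the join step the component sum of a join is the partners' [folklore] -/
theorem compSum_join_of_lt (X Y : PGen (Pt d × Finset (Pt d))) {sj m : ℕ} (h : m < sj) :
    compSum L s φ (.join X Y sj) m = compSum L s φ X m + compSum L s φ Y m := by
  conv_lhs => unfold compSum
  rw [if_neg (Nat.not_le.2 h)]

/-- **before its step, the component sum of a chain of joins is the sum over the members** [folklore] -/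
theorem compSum_chainJoin_of_lt {sj m : ℕ} (h : m < sj) :
    ∀ (A : PGen (Pt d × Finset (Pt d))) (Bs : List (PGen (Pt d × Finset (Pt d)))),
      compSum L s φ (chainJoin A Bs sj) m = compSum L s φ A m + (Bs.map fun B => compSum L s φ B m).sum
  | A, [] => by simp [chainJoin]
  | A, B :: Bs => by
      rw [chainJoin, compSum_chainJoin_of_lt h (PGen.join A B sj) Bs, compSum_join_of_lt A B h, List.map_cons,
        List.sum_cons, add_assoc]

/-- **before the step of `c`, the component sum of `joinP c` is the sum over the listed `PGen`s** (the partless junk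
birth contributes nothing). [folklore] -/
theorem compSum_joinP_of_lt {α π : Type*} (P : Pedigree α π) (c : α) {m : ℕ} (h : m < P.step c) :
    ∀ Ls : List (PGen (Pt d × Finset (Pt d))),
      compSum L s φ (P.joinP c Ls) m = (Ls.map fun B => compSum L s φ B m).sum
  | [] => by simp [Pedigree.joinP, compSum_birth_of_lt h]
  | A :: As => by
      rw [show P.joinP c (A :: As) = chainJoin A As (P.step c) from rfl, compSum_chainJoin_of_lt h A As,
        List.map_cons, List.sum_cons]

end Chain

/-! ## §2 One-step additivity of the component sum along `pedOf` -/

section OneStep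

variable {L : ℕ} {s : ℕ → ℕ} {φ : ℕ → ℝ}
variable {H : ComponentHistory (Pt d × Finset (Pt d))} {rnw : ℕ → Pt d × Finset (Pt d) → Bool}
  {ord : ℕ → Pt d × Finset (Pt d) → List ((Pt d × Finset (Pt d)) ⊕ (Pt d × Finset (Pt d)))}

/-- a sum over a duplicate-free list is the sum over its set of entries [folklore] -/
theorem sum_map_eq_sum_toFinset {γ : Type*} [DecidableEq γ] {l : List γ} (hl : l.Nodup) (f : γ → ℝ) :
    (l.map f).sum = ∑ x ∈ l.toFinset, f x :=
  (List.sum_toFinset f hl).symm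

/-- **ONE-STEP ADDITIVITY** (under an admissible order): for `c ∈ comp (j+1)` and `m ≤ j`, the component sum at `m`
of the `PGen` of `(j+1, c)` is the sum over the old parts `p` of `c` of the component sums at `m` of the `PGen`s of
`(j, p)` — the join at `j + 1` has not happened at `m`, a renewed part is transparent, a new region of step `j + 1`
contributes nothing at `m`. [folklore] -/
theorem compSum_toPGen_succ (hO : OrderOK H ord) {j : ℕ} {c : Pt d × Finset (Pt d)} (hc : c ∈ H.comp (j + 1))
    {m : ℕ} (hm : m ≤ j) :
    compSum L s φ ((pedOf H rnw ord).toPGen id (j + 1, c)) m =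
      ((H.parts (j + 1) c).map fun p => compSum L s φ ((pedOf H rnw ord).toPGen id (j, p)) m).sum := by
  rw [toPGen_succ H rnw ord id hc,
    compSum_joinP_of_lt (pedOf H rnw ord) (j + 1, c) (show m < (pedOf H rnw ord).step (j + 1, c) by
      rw [step_pedOf]; exact Nat.lt_succ_of_le hm),
    List.map_map]
  have hcomp : ((fun B : PGen (Pt d × Finset (Pt d)) => compSum L s φ B m) ∘ fun q =>
      Sum.elim (fun p => if rnw j p = true then PGen.renew ((pedOf H rnw ord).toPGen id (j, p)) j
          else (pedOf H rnw ord).toPGen id (j, p))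
        (fun n => PGen.birth (j + 1) (H.cls n) (id n)) q) =
      Sum.elim (fun p => compSum L s φ ((pedOf H rnw ord).toPGen id (j, p)) m) (fun _ => (0 : ℝ)) := by
    funext q
    cases q with
    | inl p =>
        simp only [Function.comp_apply, Sum.elim_inl]
        split_ifs
        · rfl
        · rfl
    | inr n =>
        simp only [Function.comp_apply, Sum.elim_inr]
        exact compSum_birth_of_lt (Nat.lt_succ_of_le hm)
  rw [hcomp, ((hO (j + 1) c hc).map _).sum_eq, sum_map_sum_elim]
  change ((H.parts (j + 1) c).map _).sum + ((H.news (j + 1) c).map fun _ => (0 : ℝ)).sum = _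
  rw [List.map_const', List.sum_replicate, smul_zero, add_zero]

end OneStep

/-! ## §3 The forest volume identity -/

section Forest

variable (L : ℕ) (s : ℕ → ℕ) (φ : ℕ → ℝ)

/-- **THE WEIGHTED TREE VOLUME** of the name `a` of a pedigree up to `K`: `Σ_{m ≤ K} u_m·compSum φ (toPGen id a) m` — the
left-hand side of `HistoryBankingFlatJunction.flat_volume_le_lifeCost` (`φ = id`). [folklore] -/
def treeVol {α : Type*} (Pd : Pedigree α (Pt d × Finset (Pt d))) (u : ℕ → ℝ) (K : ℕ) (a : α) : ℝ :=
  ∑ m ∈ Finset.range (K + 1), u m * compSum L s φ (Pd.toPGen id a) m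

variable {L s φ}

/-- the tree volume is nonnegative for `u, φ ≥ 0` [folklore] -/
theorem treeVol_nonneg {α : Type*} (Pd : Pedigree α (Pt d × Finset (Pt d))) {u : ℕ → ℝ} (hu : ∀ n, 0 ≤ u n)
    (hφ : ∀ v, 0 ≤ φ v) (K : ℕ) (a : α) : 0 ≤ treeVol L s φ Pd u K a :=
  Finset.sum_nonneg fun m _ => mul_nonneg (hu m) (compSum_nonneg hφ _ _)

variable {H : ComponentHistory (Pt d × Finset (Pt d))} {rnw : ℕ → Pt d × Finset (Pt d) → Bool}
  {ord : ℕ → Pt d × Finset (Pt d) → List ((Pt d × Finset (Pt d)) ⊕ (Pt d × Finset (Pt d)))}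

/-- the tree volume of a component of the next level, split at the last step: the parts' tree volumes plus the
top-level term (one-step additivity summed over `m ≤ j`) [folklore] -/
theorem treeVol_succ (hW : H.WF) (hO : OrderOK H ord) (u : ℕ → ℝ) {j : ℕ} {c : Pt d × Finset (Pt d)}
    (hc : c ∈ H.comp (j + 1)) :
    treeVol L s φ (pedOf H rnw ord) u (j + 1) (j + 1, c) =
      ((H.parts (j + 1) c).map fun p => treeVol L s φ (pedOf H rnw ord) u j (j, p)).sum +
        u (j + 1) * compSum L s φ ((pedOf H rnw ord).toPGen id (j + 1, c)) (j + 1) := by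
  unfold treeVol
  rw [Finset.sum_range_succ]
  congr 1
  rw [sum_map_eq_sum_toFinset (hW.parts_nodup (j + 1) c), Finset.sum_comm]
  refine Finset.sum_congr rfl fun m hm => ?_
  rw [compSum_toPGen_succ hO hc (Nat.lt_succ_iff.1 (Finset.mem_range.1 hm)),
    sum_map_eq_sum_toFinset (hW.parts_nodup (j + 1) c), Finset.mul_sum]

/-- **THE FOREST VOLUME IDENTITY** (under `WF` and an admissible order): the weighted tree volumes of the components live
at `K`, plus those of the components that died at each `j < K`, add up to the level-by-level weighted volume
`Σ_{m ≤ K} u_m·Σ_{c ∈ comp m} compSum φ (toPGen id (m, c)) m` — every component of every level lies on exactly one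
maximal pedigree (the additive twin of `forest_evProd_eqR` ∕ `forest_regions_eq`). [folklore] -/
theorem forest_treeVol_eq (hW : H.WF) (hO : OrderOK H ord) (u : ℕ → ℝ) : ∀ K : ℕ,
    (∑ c ∈ H.comp K, treeVol L s φ (pedOf H rnw ord) u K (K, c)) +
        ∑ j ∈ Finset.range K, ∑ c ∈ H.died j, treeVol L s φ (pedOf H rnw ord) u j (j, c) =
      ∑ m ∈ Finset.range (K + 1), u m * ∑ c ∈ H.comp m, compSum L s φ ((pedOf H rnw ord).toPGen id (m, c)) m
  | 0 => by simp [treeVol, Finset.mul_sum]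
  | K + 1 => by
      have ih := forest_treeVol_eq hW hO u K
      have hstep : ∑ c ∈ H.comp (K + 1), treeVol L s φ (pedOf H rnw ord) u (K + 1) (K + 1, c) =
          (∑ c ∈ H.comp (K + 1), ((H.parts (K + 1) c).map fun p => treeVol L s φ (pedOf H rnw ord) u K (K, p)).sum) +
            u (K + 1) * ∑ c ∈ H.comp (K + 1), compSum L s φ ((pedOf H rnw ord).toPGen id (K + 1, c)) (K + 1) := by
        rw [Finset.mul_sum, ← Finset.sum_add_distrib]
        exact Finset.sum_congr rfl fun c hc => treeVol_succ hW hO u hc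
      have htel := H.sum_comp_eq_continued_add_died hW K (fun a => treeVol L s φ (pedOf H rnw ord) u K (K, a))
      rw [Finset.sum_range_succ _ (K + 1), Finset.sum_range_succ (fun j => ∑ c ∈ H.died j, _) K, hstep, ← ih, htel]
      ring

/-- the same with the live∕dead split read as ONE sum bounded above: the level-by-level weighted volume of any
per-component quantity `v` below the component sums is below the forest's tree volumes (`u ≥ 0`). [folklore] -/
theorem sum_level_le_forest (hW : H.WF) (hO : OrderOK H ord) {u : ℕ → ℝ} (hu : ∀ n, 0 ≤ u n)
    {v : ℕ → (Pt d × Finset (Pt d)) → ℝ}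
    (hv : ∀ m c, c ∈ H.comp m → v m c ≤ compSum L s φ ((pedOf H rnw ord).toPGen id (m, c)) m) (K : ℕ) :
    ∑ m ∈ Finset.range (K + 1), u m * ∑ c ∈ H.comp m, v m c ≤
      (∑ c ∈ H.comp K, treeVol L s φ (pedOf H rnw ord) u K (K, c)) +
        ∑ j ∈ Finset.range K, ∑ c ∈ H.died j, treeVol L s φ (pedOf H rnw ord) u j (j, c) := by
  rw [forest_treeVol_eq hW hO u K]
  exact Finset.sum_le_sum fun m _ => mul_le_mul_of_nonneg_left (Finset.sum_le_sum fun c hc => hv m c hc) (hu m)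

end Forest

/-! ## §4 Pass V: realised volumes below the maximal ones; M2 brick B's volume factor along the forest -/

section PassV

variable {I : RunInputM d}

/-- **A LIVE DISSOLVED COMPONENT's DOMAIN HAS AT MOST `compSum id (pedMV.toPGen id (m, c)) m` CUBES**: its domain is the
current domain of its realised `PGen` (`domL_eq_curDomain_pedMV`), which lies in the maximal domain (A3a
`curDomain_subset_MDP`), and the component sum of a single structure past its last event is the maximal volume (A3b
`compSum_of_le`). [folklore] -/
theorem card_snd_le_compSum (hN : I.NewOK) (hRm : ∀ t k, I.Rm t k ≤ I.R t)
    (hRmS : ∀ t k, I.Rm t (k + 1) ≤ I.R (t + 1)) (hRm2 : ∀ t, 2 ≤ I.Rm t 1) (hD : I.NewDisjoint) (hL : 0 < I.L)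
    {m : ℕ} {c : Pt d × Finset (Pt d)} (hc : c ∈ I.histV.comp m) :
    ((c.2).card : ℝ) ≤ compSum I.L I.s (fun v => (v : ℝ)) (I.pedMV.toPGen id (m, c)) m := by
  have hW := RunInputM.wf_histV hN hRm hD hL
  have hG := RunInputM.levelClausesW_histV hN hRm hRmS hRm2 hD hL
  have hreal := RunInputM.realisesW_pedMV hN hRm hRmS hRm2 hD hL hc
  have hlast : (I.pedMV.toPGen id (m, c)).lastStep ≤ m := (lastStep_toPGen_ordOf hW hG hc).2
  rw [compSum_of_le _ (adm_of_realisesW _ _ hreal le_rfl) hlast]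
  have hsub : c.2 ⊆ MDP I.L I.s (I.pedMV.toPGen id (m, c)) m := by
    rw [RunInputM.domL_eq_curDomain_pedMV hN hRm hRmS hRm2 hD hL hc]
    exact curDomain_subset_MDP hreal hlast
  exact_mod_cast Finset.card_le_card hsub

/-- **THE LEVEL-BY-LEVEL REALISED VOLUME IS BELOW THE FOREST's TREE VOLUMES** (pass V, weights `u ≥ 0`):
`Σ_{m ≤ K} u_m·Σ_{c ∈ histV.comp m} #c.2 ≤ Σ_{c ∈ histV.comp K} treeVol id pedMV u K (K, c) + Σ_{j < K} Σ_{c ∈ histV.died j}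
treeVol id pedMV u j (j, c)`. [folklore] -/
theorem sum_level_volume_le_forest (hN : I.NewOK) (hRm : ∀ t k, I.Rm t k ≤ I.R t)
    (hRmS : ∀ t k, I.Rm t (k + 1) ≤ I.R (t + 1)) (hRm2 : ∀ t, 2 ≤ I.Rm t 1) (hD : I.NewDisjoint) (hL : 0 < I.L)
    {u : ℕ → ℝ} (hu : ∀ n, 0 ≤ u n) (K : ℕ) :
    ∑ m ∈ Finset.range (K + 1), u m * ∑ c ∈ I.histV.comp m, ((c.2).card : ℝ) ≤
      (∑ c ∈ I.histV.comp K, treeVol I.L I.s (fun v => (v : ℝ)) I.pedMV u K (K, c)) +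
        ∑ j ∈ Finset.range K, ∑ c ∈ I.histV.died j, treeVol I.L I.s (fun v => (v : ℝ)) I.pedMV u j (j, c) :=
  sum_level_le_forest (RunInputM.wf_histV hN hRm hD hL)
    (orderOK_ordOf (RunInputM.wf_histV hN hRm hD hL) (RunInputM.levelClausesW_histV hN hRm hRmS hRm2 hD hL)) hu
    (fun _ _ hc => card_snd_le_compSum hN hRm hRmS hRm2 hD hL hc) K

/-- a power of `Λ ≥ 1` as an exponential of the logarithm [folklore] -/
theorem pow_eq_exp_log_mul {Λ : ℝ} (hΛ : 1 ≤ Λ) (n : ℕ) : Λ ^ n = Real.exp (Real.log Λ * n) := by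
  rw [Real.exp_mul, Real.exp_log (by linarith), Real.rpow_natCast]

/-- **M2 BRICK B's VOLUME FACTOR IS BELOW THE EXPONENTIAL OF THE FOREST's TREE VOLUMES** (pass V; per-cube level costs
`Λ j ≥ 1`, weights `u = log ∘ Λ`): `∏_{j ≤ K} ∏_{c ∈ histM.comp j} Λ j ^ #c.2 ≤ exp (Σ_{c ∈ histV.comp K} treeVol id pedMV
(log ∘ Λ) K (K, c) + Σ_{j < K} Σ_{c ∈ histV.died j} treeVol id pedMV (log ∘ Λ) j (j, c))` — `prod_pow_card_comp_histV`
(dissolution keeps the level products), then §3 on the realised volumes. [folklore] -/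
theorem prod_pow_card_le_exp_forest (hN : I.NewOK) (hRm : ∀ t k, I.Rm t k ≤ I.R t)
    (hRmS : ∀ t k, I.Rm t (k + 1) ≤ I.R (t + 1)) (hRm2 : ∀ t, 2 ≤ I.Rm t 1) (hD : I.NewDisjoint) (hL : 0 < I.L)
    {Λ : ℕ → ℝ} (hΛ : ∀ j, 1 ≤ Λ j) (K : ℕ) :
    ∏ j ∈ Finset.range (K + 1), ∏ c ∈ I.histM.comp j, Λ j ^ (c.2).card ≤
      Real.exp ((∑ c ∈ I.histV.comp K, treeVol I.L I.s (fun v => (v : ℝ)) I.pedMV (fun j => Real.log (Λ j)) K (K, c)) +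
        ∑ j ∈ Finset.range K, ∑ c ∈ I.histV.died j,
          treeVol I.L I.s (fun v => (v : ℝ)) I.pedMV (fun j => Real.log (Λ j)) j (j, c)) := by
  have hlev : ∀ j, ∏ c ∈ I.histM.comp j, Λ j ^ (c.2).card =
      Real.exp (Real.log (Λ j) * ∑ c ∈ I.histV.comp j, ((c.2).card : ℝ)) := fun j => by
    rw [← RunInputM.prod_pow_card_comp_histV hN hRm hD (Λ j) j, Finset.mul_sum, Real.exp_sum]
    exact Finset.prod_congr rfl fun c _ => pow_eq_exp_log_mul (hΛ j) _
  rw [Finset.prod_congr rfl fun j _ => hlev j, ← Real.exp_sum, Real.exp_le_exp]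
  exact sum_level_volume_le_forest hN hRm hRmS hRm2 hD hL (fun j => Real.log_nonneg (hΛ j)) K

/-- **… EQUIVALENTLY, A PRODUCT OVER THE FOREST**: the volume factor is at most the product over the LIVE components of
`exp (treeVol …)` times the product over the DEAD ones — the live factors are what M5-2c banks into `pshapeTH` (κ :=
`costT`, via `flat_volume_le_lifeCost_genT`), the dead ones ride with the dead genealogies' event products into the
resummation. [folklore] -/
theorem prod_pow_card_le_prod_exp_forest (hN : I.NewOK) (hRm : ∀ t k, I.Rm t k ≤ I.R t)
    (hRmS : ∀ t k, I.Rm t (k + 1) ≤ I.R (t + 1)) (hRm2 : ∀ t, 2 ≤ I.Rm t 1) (hD : I.NewDisjoint) (hL : 0 < I.L)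
    {Λ : ℕ → ℝ} (hΛ : ∀ j, 1 ≤ Λ j) (K : ℕ) :
    ∏ j ∈ Finset.range (K + 1), ∏ c ∈ I.histM.comp j, Λ j ^ (c.2).card ≤
      (∏ c ∈ I.histV.comp K,
          Real.exp (treeVol I.L I.s (fun v => (v : ℝ)) I.pedMV (fun j => Real.log (Λ j)) K (K, c))) *
        ∏ j ∈ Finset.range K, ∏ c ∈ I.histV.died j,
          Real.exp (treeVol I.L I.s (fun v => (v : ℝ)) I.pedMV (fun j => Real.log (Λ j)) j (j, c)) := by
  refine (prod_pow_card_le_exp_forest hN hRm hRmS hRm2 hD hL hΛ K).trans (le_of_eq ?_)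
  rw [Real.exp_add, Real.exp_sum, Real.exp_sum]
  exact congrArg _ (Finset.prod_congr rfl fun j _ => Real.exp_sum _ _)

end PassV

end

end Summit.QuantumFields.BalabanUV.T4Continuum.HistoryBankingForestVolume
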